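import Summits.ABC.IUTFork.Cor312RegimeVerbatimPrVolExactPositive
import Literature.IUT.LogVolume.GenuineSupportPrimesBound
import Literature.IUT.LogVolume.FakeAdeleIndexLocalDegree
import Literature.IUT.LogVolume.RescaledCompletionInvariants
import HarnessLib

/-!
# [IUTchIII] Cor. 3.12 — the regime decomposition at the print-normalised sharp setting of record, IX: `−|log(Θ)|(𝟙) > 0`
# for EVERY number field `F ≠ ℚ` (Minkowski + Dedekind + abc-iut-c312-5's ramified gain)

PROOF-ONLY support piece of the abc-iut cell (Cor. 3.12 cone, D-0067; seat abc-iut-w4-d107, gen 5; part 23 of the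
`Cor312NegLogThetaUpperPrVol*` / `Cor312RegimeVerbatimPrVol*` chain, sequel of part 18 `Cor312RegimeVerbatimPrVolExactPositive`;
with part 22 `…ExactDyadicSplit` (`−|log(Θ)|(𝟙) = 0` over `ℚ`) it gives the DICHOTOMY «`−|log(Θ)|(𝟙) = 0` over `ℚ`, `> 0` over every
other number field»). TAKES NO SIDE on [IUTchIII] Cor. 3.12; theorems only, 0 `def`s, no new `Prop` fact, no instance.

* `negLogTheta_settingPrVolSharp_trivial_pos_of_dvd_discr` — if a prime `q` divides `disc(F)`, then `0 < −|log(Θ)|(𝟙)` for every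
  pilot datum over `F` and every context: Dedekind's discriminant theorem gives a place `u | q` with `e_u ≥ 2`
  (campaign-S `Cor22.exists_ramified_place_of_dvd_discr`, `absRamificationIdx_rescaledCompletion`), and part 18 applies;
* **`negLogTheta_settingPrVolSharp_trivial_pos_of_one_lt_finrank`** — if `[F : ℚ] > 1` then `0 < −|log(Θ)|(𝟙)`: by Minkowski
  (Mathlib `NumberField.abs_discr_gt_two`) some prime divides `disc(F)`.
So the one datum-independent number of the exact criterion (parts 12/14) is `0` exactly over `ℚ` (part 22) and a genuinely
POSITIVE hull inflation over every other base field — in particular over every base field of genuine Θ-data.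
HONEST SCOPE as in parts 7–22; nothing here asserts or denies [IUTchIII] Cor. 3.12 for initial Θ-data. typed ≠ proved;
instantiated ≠ endorsed. [claim: Mochizuki2012, status: disputed] [cite: NeukirchANT1999, Ch. III (2.12), (2.17)]
[cite: DupuyHilado2025, §3.9, §4.9]
-/

noncomputable section

open Set Function NumberField IsDedekindDomain
open scoped Pointwise

namespace Summit.ABC.IUTFork.Thm311.Real

open Cor312 Cor312.Setting Cor312Vol Literature.IUT.LogThetaLattice Literature.IUT.LogVolume
  Literature.NumberTheory.NumberFields

variable {F : Type} [Field F] [NumberField F] (X : PilotData F) {logv : PadicLogs F} (hlog : LogvAnalytic logv)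
  (M : Type) [Field M] [NumberField M]
  (archPk : ∀ (j : (thetaIndex X).Label) (vQ : (thetaIndex X).VQ), Set ((logShellsDH X logv).Packet j vQ))
  (archSub : ∀ (j : (thetaIndex X).Label) (v : (thetaIndex X).V),
    Set ((logShellsDH X logv).Packet j ((thetaIndex X).over v)))
  (Ψ : ℤ → ∀ v : (thetaIndex X).V, v ∈ (thetaIndex X).Vbad → Set ((logShellsDH X logv).StarPacket v))
  (act : ℤ → ∀ v : (thetaIndex X).V, v ∈ (thetaIndex X).Vbad →
    (logShellsDH X logv).StarPacket v → Module.End ℚ ((logShellsDH X logv).StarPacket v))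
  (Mmod : ℤ → ∀ j : (thetaIndex X).LabelStar, Set ((logShellsDH X logv).GlobalPacket j.1))
  (region : ℤ → ∀ j : (thetaIndex X).LabelStar, FinDivisor M → ∀ vQ : (thetaIndex X).VQ,
    Set ((logShellsDH X logv).Packet j.1 vQ))
  (n : ℤ) {HT : Type} {LogLink : HT → HT → Type} {IsFull : ∀ {s t : HT}, LogLink s t → Prop}
  (lat : LGPGaussianLogThetaLattice LogLink IsFull)
  {Frd : Type} {IsoF : Frd → Frd → Type} {Ob : Frd → Type} {realify : Frd → Frd} {Strip : Type}
  {IsoS : Strip → Strip → Type} {Mv : ∀ v : (thetaIndex X).V, v ∈ (thetaIndex X).Vbad → Type}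
  [∀ v h, Monoid (Mv v h)]
  (sig : GlobalLGPFrobenioidSignature (thetaIndex X).lstar (thetaIndex X).V (· ∈ (thetaIndex X).Vbad)
    Frd IsoF Ob realify Strip IsoS Mv)
  (split : SplittingMonoids Mv) {ObΔ : Type} {N : ∀ v : (thetaIndex X).V, v ∈ (thetaIndex X).Vbad → Type}
  [∀ v h, Monoid (N v h)] (qData : QPilotData ObΔ N)

/-- **If a prime `q` divides `disc(F)`, then `0 < −|log(Θ)|(𝟙)`** (no hypothesis on `S`): a place `u | q` of `F` ramifies
(Dedekind), and the unit-box hull inflation at the `q`-packets is strictly positive (part 18).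
[cite: NeukirchANT1999, Ch. III (2.12)] [cite: DupuyHilado2025, §3.9, §4.9] [claim: Mochizuki2012, status: disputed] -/
theorem negLogTheta_settingPrVolSharp_trivial_pos_of_dvd_discr {q : ℕ} (hq : q.Prime)
    (h : (q : ℤ) ∣ NumberField.discr F) :
    (0 : WithTop ℝ) <
      (settingPrVolSharp X hlog M archPk archSub Ψ act Mmod region n lat sig split qData (fun _ _ => 1) (fun _ _ _ => 1)
        (fun _ _ => one_ne_zero) (fun _ _ _ => norm_one)).negLogTheta := by
  obtain ⟨u, hres, hram⟩ := Cor22.exists_ramified_place_of_dvd_discr F hq h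
  haveI : Fact q.Prime := ⟨hq⟩
  have hvp : ((q : ℕ) : 𝓞 F) ∈ u.asIdeal := hres ▸ natCast_residueChar_mem F u
  have hv : (thetaIndex X).over (.inr u) = .inr ⟨q, hq⟩ := by
    show (Sum.inr ⟨residueChar F u, residueChar_prime F u⟩ : RatPlace) = Sum.inr ⟨q, hq⟩
    congr 1
    exact Subtype.ext hres
  have he : 2 ≤ absRamificationIdx ((⟨q, hq⟩ : Nat.Primes) : ℕ) (RescaledCompletion F ((⟨q, hq⟩ : Nat.Primes) : ℕ) u hvp) := by
    show 2 ≤ absRamificationIdx q (RescaledCompletion F q u hvp)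
    rw [absRamificationIdx_rescaledCompletion F q u hvp]
    exact hram
  exact negLogTheta_settingPrVolSharp_trivial_pos_of_two_le_ramificationIdx X hlog M archPk archSub Ψ act Mmod region n lat sig
    split qData ⟨q, hq⟩ u hv hvp he

/-- **`−|log(Θ)|(𝟙) > 0` OVER EVERY NUMBER FIELD `F ≠ ℚ`**: if `[F : ℚ] > 1`, Minkowski's bound (`|disc F| > 2`, Mathlib
`NumberField.abs_discr_gt_two`) gives a prime dividing `disc(F)`, and the previous theorem applies. With part 22
(`negLogTheta_settingPrVolSharp_trivial_eq_zero_rat`) this is the dichotomy «`= 0` over `ℚ`, `> 0` otherwise».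
[cite: NeukirchANT1999, Ch. III (2.17)] [cite: DupuyHilado2025, §3.9, §4.9] [claim: Mochizuki2012, status: disputed] -/
theorem negLogTheta_settingPrVolSharp_trivial_pos_of_one_lt_finrank (hF : 1 < Module.finrank ℚ F) :
    (0 : WithTop ℝ) <
      (settingPrVolSharp X hlog M archPk archSub Ψ act Mmod region n lat sig split qData (fun _ _ => 1) (fun _ _ _ => 1)
        (fun _ _ => one_ne_zero) (fun _ _ _ => norm_one)).negLogTheta := by
  have hd : 2 < |NumberField.discr F| := NumberField.abs_discr_gt_two hF
  have hne1 : (NumberField.discr F).natAbs ≠ 1 := by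
    intro h1
    have : |NumberField.discr F| = 1 := by rw [Int.abs_eq_natAbs, h1]; rfl
    omega
  obtain ⟨q, hq, hqd⟩ := Nat.exists_prime_and_dvd hne1
  have h : (q : ℤ) ∣ NumberField.discr F := Int.natCast_dvd.mpr hqd
  exact negLogTheta_settingPrVolSharp_trivial_pos_of_dvd_discr X hlog M archPk archSub Ψ act Mmod region n lat sig split qData
    hq h

end Summit.ABC.IUTFork.Thm311.Real

end
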